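import Literature.NumberTheory.EllipticCurves.HeegnerGeomPrincipalSystemProofs
import HarnessLib

/-!
# Transversal calculus for norm points in `E(K̄)` (Gross 1991 §3 / Perrin-Riou 1987 §3.2–3.4 / Howard 2004 §3.3)

Topic `NumberTheory/EllipticCurves` (complex multiplication / Heegner points). THEOREMS ONLY (no definition,
no named fact; net Literature debt `0`). Cell `bsd-print-x9`, seat x9-p1 (LEAD; envelope infrastructure part III-a
for the cruxes `PrintX9.HowardContainmentLightFrame[Pinned]OfPrint`, stmt-BirchSwinnertonDyer-25235 / -26359).

The tree's Heegner modules (`HeegnerModuleIndex`: `IsHeegnerNormPoint`, `HeegnerFamily`;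
`CastellaGrossiLeeSkinner2022.StabilizedHeegnerData`) record the norms `Norm_{K_nK[c]/K_n} P[c]` of Heegner points
as TRANSVERSAL SUMS `∑_{r ∈ R} r • x` in the `Γ_K`-module `E(K̄)`: `R ⊆ Gal(K̄/K_n)` a finite set meeting every
coset of `Gal(K̄/K[c]) = ringClassSubgroup K c jbar` exactly once. This file proves the bookkeeping every comparison
of such modules needs and print performs silently ("`Norm_{K[p^{k+1}]/K_k} = Norm_{K[p^k]/K_k} ∘ Tr_{K[p^{k+1}]/K[p^k]}`",
Howard §3.3; Perrin-Riou §3.3): the sum does not depend on the transversal (`sum_smul_eq_of_transversal`), a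
transversal of `H` in `L` through an intermediate `M` is the product of transversals (`sum_smul_eq_sum_sum_smul`),
`Gal(K̄/K[c']) ≤ Gal(K̄/K[c])` for `c ∣ c'` (`ringClassSubgroup_anti`), and the ONE-STEP DESCENT of norms along the
ring class tower, `Norm_{K[p^{d+1}]/L} P[p^{d+1}] = a_p · Norm_{K[p^d]/L} P[p^d] − ∑_{Gal(K[p^d]/L)} P[p^{d-1}]` for
any field `L = K̄^{Λ}` between `K` and `K[p^d]` (`sum_transversal_smul_eq_frobeniusTrace_smul_sub_of_le`, from the
vertical distribution relation `HeegnerGeomPrincipalSystemProofs.sum_transversal_smul_eq_frobeniusTrace_smul_sub`).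

HONEST FRAMING: group-theoretic bookkeeping plus the cited CM relation; nothing on `L`-functions, Selmer groups or
BSD is asserted. References: [GrossLMS1991] §3 (Tr_{K_n/K_m}); [PerrinRiou1987BSMF] §3.2–3.4 (tr_{H_{cp^n}/D_n});
[Howard2004HeegnerKolyvagin] §3.3 (P_k[n] = Norm P[np^{k+1}]).
-/

set_option autoImplicit false

noncomputable section

open scoped Classical

namespace Literature.NumberTheory.EllipticCurves

open WeierstrassCurve RingClassField

variable {K : Type} [Field K] [NumberField K]

/-! ## §1 `K[c] ⊆ K[c']` for `c ∣ c'`, on the `Γ_K` side -/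

/-- **`Gal(K̄/K[c']) ≤ Gal(K̄/K[c])` for `c ∣ c'`** (`K[c] ⊆ K[c']`, `ringClassField_mono`, Cox §9.A), for the
tree's `ringClassSubgroup` — through the dictionary of `HeegnerGeomGaloisTransferProofs`.
[cite: Cox2013, §9.A (ring class fields of orders 𝒪 ⊆ 𝒪′)] -/
theorem ringClassSubgroup_anti (hK : IsImaginaryQuadratic K) (jbar : AlgebraicClosure K →+* ℂ)
    {c c' : ℕ} (hcc' : c ∣ c') (hc' : c' ≠ 0) :
    ringClassSubgroup K c' jbar ≤ ringClassSubgroup K c jbar := by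
  intro σ hσ
  obtain ⟨σC, hσC⟩ := exists_ringEquiv_apply_eq_smul jbar σ
  refine mem_ringClassSubgroup_of_ringEquiv_apply_eq_self hσC fun x hx ↦ ?_
  exact ringEquiv_apply_eq_self_of_mem_ringClassSubgroup hK hc' hσ hσC
    (ringClassField_mono hK _ hcc' hc' hx)

/-! ## §2 Transversal sums do not depend on the transversal -/

section Transversal

variable {Γ : Type*} [Group Γ] {M : Type*} [AddCommMonoid M] [DistribMulAction Γ M]

/-- **A transversal sum `∑_{r ∈ R} r • x` over a transversal `R ⊆ L` of `H` in `L` does not depend on `R`**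
when `H` fixes `x` (each summand depends only on the coset `rH`). [cite: GrossLMS1991, §3 (Tr_{K_n/K_m} well defined)] -/
theorem sum_smul_eq_of_transversal {L H : Subgroup Γ} {R R' : Finset Γ} (hR : ∀ r ∈ R, r ∈ L)
    (hR' : ∀ r ∈ R', r ∈ L) (htR : ∀ τ ∈ L, ∃! r, r ∈ R ∧ r⁻¹ * τ ∈ H)
    (htR' : ∀ τ ∈ L, ∃! r, r ∈ R' ∧ r⁻¹ * τ ∈ H) {x : M} (hx : ∀ σ ∈ H, σ • x = x) :
    ∑ r ∈ R, r • x = ∑ r ∈ R', r • x := by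
  -- the coset-matching maps `R → R'` and `R' → R`
  choose f hf using fun r (hr : r ∈ R) ↦ (htR' r (hR r hr)).exists
  choose g hg using fun r' (hr' : r' ∈ R') ↦ (htR r' (hR' r' hr')).exists
  refine Finset.sum_bij' (fun r hr ↦ f r hr) (fun r' hr' ↦ g r' hr') (fun r hr ↦ (hf r hr).1)
    (fun r' hr' ↦ (hg r' hr').1) (fun r hr ↦ ?_) (fun r' hr' ↦ ?_) (fun r hr ↦ ?_)
  · -- `g (f r) = r`: both represent the coset of `r`
    have h1 : (f r hr)⁻¹ * r ∈ H := (hf r hr).2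
    have h2 : (g (f r hr) (hf r hr).1)⁻¹ * f r hr ∈ H := (hg _ (hf r hr).1).2
    refine (htR r (hR r hr)).unique ⟨(hg _ (hf r hr).1).1, ?_⟩ ⟨hr, by rw [inv_mul_cancel]; exact H.one_mem⟩
    have := H.mul_mem h2 h1
    rwa [mul_assoc, mul_inv_cancel_left] at this
  · have h1 : (g r' hr')⁻¹ * r' ∈ H := (hg r' hr').2
    have h2 : (f (g r' hr') (hg r' hr').1)⁻¹ * g r' hr' ∈ H := (hf _ (hg r' hr').1).2
    refine (htR' r' (hR' r' hr')).unique ⟨(hf _ (hg r' hr').1).1, ?_⟩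
      ⟨hr', by rw [inv_mul_cancel]; exact H.one_mem⟩
    have := H.mul_mem h2 h1
    rwa [mul_assoc, mul_inv_cancel_left] at this
  · -- `r • x = f r • x`
    have h1 : (f r hr)⁻¹ * r ∈ H := (hf r hr).2
    calc r • x = (f r hr * ((f r hr)⁻¹ * r)) • x := by rw [mul_inv_cancel_left]
      _ = f r hr • x := by rw [mul_smul, hx _ h1]

/-- **Product decomposition of a transversal sum** along `H ≤ Mid ≤ L`: if `A ⊆ L` is a transversal of `Mid` in
`L`, `S ⊆ Mid` a transversal of `H` in `Mid` and `R ⊆ L` any transversal of `H` in `L`, then for `x` fixed by `H`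
`∑_{r ∈ R} r • x = ∑_{a ∈ A} a • ∑_{s ∈ S} s • x` — "`Norm_{K[c']/K_n} = Norm_{K[c]K_n/K_n} ∘ Norm_{K[c']/K[c]K_n}`".
[cite: Howard2004HeegnerKolyvagin, §3.3 (P_k[n] = Norm_{K[np^{k+1}]/K_k[n]} P[np^{k+1}])] [cite: PerrinRiou1987BSMF, §3.3] -/
theorem sum_smul_eq_sum_sum_smul {L Mid H : Subgroup Γ} (hHM : H ≤ Mid) (hML : Mid ≤ L)
    {A S R : Finset Γ} (hA : ∀ a ∈ A, a ∈ L) (htA : ∀ τ ∈ L, ∃! a, a ∈ A ∧ a⁻¹ * τ ∈ Mid)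
    (hS : ∀ s ∈ S, s ∈ Mid) (htS : ∀ μ ∈ Mid, ∃! s, s ∈ S ∧ s⁻¹ * μ ∈ H)
    (hR : ∀ r ∈ R, r ∈ L) (htR : ∀ τ ∈ L, ∃! r, r ∈ R ∧ r⁻¹ * τ ∈ H)
    {x : M} (hx : ∀ σ ∈ H, σ • x = x) :
    ∑ r ∈ R, r • x = ∑ a ∈ A, a • ∑ s ∈ S, s • x := by
  -- the product transversal `T = A · S`
  let mulAS : Γ × Γ → Γ := fun q ↦ q.1 * q.2
  have hinj : Set.InjOn mulAS ↑(A ×ˢ S) := by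
    rintro ⟨a, s⟩ hq ⟨a', s'⟩ hq' (h : a * s = a' * s')
    rw [Finset.mem_coe, Finset.mem_product] at hq hq'
    have haM : a⁻¹ * a' ∈ Mid := by
      have : a⁻¹ * a' = s * s'⁻¹ := by
        rw [inv_mul_eq_iff_eq_mul, ← mul_assoc, eq_mul_inv_iff_mul_eq, h]
      rw [this]; exact Mid.mul_mem (hS s hq.2) (Mid.inv_mem (hS s' hq'.2))
    have haa' : a = a' := (htA a' (hA a' hq'.1)).unique ⟨hq.1, haM⟩
      ⟨hq'.1, by rw [inv_mul_cancel]; exact Mid.one_mem⟩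
    subst haa'
    have hss' : s = s' := mul_left_cancel h
    subst hss'
    rfl
  set T : Finset Γ := (A ×ˢ S).image mulAS with hT
  have hTL : ∀ t ∈ T, t ∈ L := by
    intro t ht
    obtain ⟨⟨a, s⟩, hq, rfl⟩ := Finset.mem_image.mp ht
    rw [Finset.mem_product] at hq
    exact L.mul_mem (hA a hq.1) (hML (hS s hq.2))
  have htT : ∀ τ ∈ L, ∃! t, t ∈ T ∧ t⁻¹ * τ ∈ H := by
    intro τ hτ
    obtain ⟨a, ⟨haA, haτ⟩, hauniq⟩ := htA τ hτ
    obtain ⟨s, ⟨hsS, hsτ⟩, hsuniq⟩ := htS (a⁻¹ * τ) haτ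
    refine ⟨a * s, ⟨Finset.mem_image.mpr ⟨(a, s), Finset.mem_product.mpr ⟨haA, hsS⟩, rfl⟩, ?_⟩, ?_⟩
    · rwa [mul_inv_rev, mul_assoc]
    · rintro t ⟨ht, htτ⟩
      obtain ⟨⟨a', s'⟩, hq, rfl⟩ := Finset.mem_image.mp ht
      rw [Finset.mem_product] at hq
      change a' * s' = a * s
      have h1 : (a' * s')⁻¹ * τ ∈ Mid := hHM htτ
      have ha'τ : a'⁻¹ * τ ∈ Mid := by
        have : a'⁻¹ * τ = s' * ((a' * s')⁻¹ * τ) := by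
          rw [mul_inv_rev, ← mul_assoc, ← mul_assoc, mul_inv_cancel, one_mul]
        rw [this]; exact Mid.mul_mem (hS s' hq.2) h1
      have haa' : a' = a := hauniq a' ⟨hq.1, ha'τ⟩
      subst haa'
      have hs' : s'⁻¹ * (a'⁻¹ * τ) ∈ H := by rwa [mul_inv_rev, mul_assoc] at htτ
      rw [hsuniq s' ⟨hq.2, hs'⟩]
  rw [sum_smul_eq_of_transversal hR hTL htR htT hx, hT, Finset.sum_image hinj, Finset.sum_product]
  refine Finset.sum_congr rfl fun a _ ↦ ?_
  rw [Finset.smul_sum]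
  exact Finset.sum_congr rfl fun s _ ↦ mul_smul a s x

end Transversal

/-! ## §3 Finite transversals exist -/

section Exists

variable {Γ : Type*} [Group Γ]

/-- **Finite transversals of a finite-index subgroup inside another subgroup exist** (copy of the private
helper of `HeegnerNormPointExistenceProofs`; Mathlib `Subgroup.exists_isComplement_left`). [cite: GrossLMS1991, §3 (Tr_{K_n/K_m} as a finite sum over Gal(K_n/K_m))] -/
theorem exists_finset_transversal' (G H : Subgroup Γ) [G.FiniteIndex] :
    ∃ R : Finset Γ, (∀ r ∈ R, r ∈ H) ∧ ∀ τ ∈ H, ∃! r, r ∈ R ∧ r⁻¹ * τ ∈ G := by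
  obtain ⟨S, hS, -⟩ := (G.subgroupOf H).exists_isComplement_left 1
  have hSfin : S.Finite := hS.finite_left
  refine ⟨hSfin.toFinset.image (fun s : H ↦ (s : Γ)), ?_, fun τ hτ ↦ ?_⟩
  · intro r hr
    obtain ⟨s, -, rfl⟩ := Finset.mem_image.mp hr
    exact s.2
  · obtain ⟨s, hs1, hs2⟩ :=
      Subgroup.isComplement_iff_existsUnique_inv_mul_mem.mp hS ⟨τ, hτ⟩
    rw [SetLike.mem_coe, Subgroup.mem_subgroupOf, Subgroup.coe_mul, Subgroup.coe_inv] at hs1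
    refine ⟨((s : H) : Γ), ⟨Finset.mem_image.mpr ⟨s, hSfin.mem_toFinset.mpr s.2, rfl⟩, hs1⟩, ?_⟩
    rintro r ⟨hr, hrG⟩
    obtain ⟨s', hs', rfl⟩ := Finset.mem_image.mp hr
    have hs'S : s' ∈ S := hSfin.mem_toFinset.mp hs'
    have h := hs2 ⟨s', hs'S⟩ (by
      show ((s' : H)⁻¹ * ⟨τ, hτ⟩ : H) ∈ ((G.subgroupOf H : Subgroup H) : Set H)
      rw [SetLike.mem_coe, Subgroup.mem_subgroupOf, Subgroup.coe_mul, Subgroup.coe_inv]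
      exact hrG)
    rw [← h]

end Exists

/-! ## §4 One-step descent of norms along the ring class tower -/

/-- **One-step descent of Heegner norms** (Howard 2004 §3.3 / Perrin-Riou 1987 §3.3, the formula behind
`Norm_{K[p^{d+1}]/K_k} P[p^{d+1}] = a_p · Norm_{K[p^d]/K_k} P[p^d] − Norm_{K[p^d]/K_k}(P[p^{d-1}])` for
`K_k ⊆ K[p^d]`): for `E = W/ℚ` at its own level `N_E`, `K` imaginary quadratic with the Heegner hypothesis, an
orientation `β`, a good prime `p`, the principal points `x₀, x₁, x₂ ∈ E(K̄)` of conductors `p^e, p^{e+1}, p^{e+2}`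
(part II: `exists_geomPoint_principal`), ANY subgroup `Λ ≥ Gal(K̄/K[p^{e+1}])` (e.g. `Gal(K̄/K_k)` with
`K_k ⊆ K[p^{e+1}]`), ANY finite transversal `A ⊆ Λ` of `Gal(K̄/K[p^{e+1}])` in `Λ` and ANY finite transversal
`R ⊆ Λ` of `Gal(K̄/K[p^{e+2}])` in `Λ`:
`∑_{r ∈ R} r • x₂ = a_p • ∑_{a ∈ A} a • x₁ − ∑_{a ∈ A} a • x₀`. (Product decomposition of `R` through
`Gal(K̄/K[p^{e+1}])`, the vertical distribution relation of `HeegnerGeomPrincipalSystemProofs` on the inner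
sum, and independence of the transversal.) [cite: Howard2004HeegnerKolyvagin, §3.3 (norms of Heegner points along the towers)]
[cite: PerrinRiou1987BSMF, §3.3 (relations de distribution)] [cite: Darmon2004, Prop. 3.10 (case ℓ ∣ n)] -/
theorem sum_transversal_smul_eq_frobeniusTrace_smul_sub_of_le {W : WeierstrassCurve ℚ} [W.IsElliptic]
    [W.IsGloballyMinimal] [NeZero (W.conductorNorm ℤ)] (hK : IsImaginaryQuadratic K)
    (hH : SatisfiesHeegnerHypothesis (W.conductorNorm ℤ) K)
    (Dt : ModularForms.ModularParametrizationData W (W.conductorNorm ℤ)) {β : ℤ}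
    (hβ : (4 * (W.conductorNorm ℤ : ℕ) : ℤ) ∣ β ^ 2 - NumberField.discr K)
    (jbar : AlgebraicClosure K →+* ℂ) {p : ℕ} (hp : p.Prime) (hpN : ¬ p ∣ W.conductorNorm ℤ) (e : ℕ)
    {x₀ x₁ x₂ : WeierstrassCurve.geomPoints (W.baseChange K)}
    (hx₀ : complexPoint W jbar x₀ =
      ModularForms.heegnerPointComplexOfConductor Dt (NumberField.discr K) β (p ^ e))
    (hx₁ : complexPoint W jbar x₁ =
      ModularForms.heegnerPointComplexOfConductor Dt (NumberField.discr K) β (p ^ (e + 1)))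
    {P₂ : (W.baseChange (ringClassField K (jbar.comp (algebraMap K (AlgebraicClosure K))) (p ^ (e + 2)))).toAffine.Point}
    (hx₂ : complexPoint W jbar x₂ = WeierstrassCurve.Affine.Point.map (W' := W)
      (ringClassField K (jbar.comp (algebraMap K (AlgebraicClosure K))) (p ^ (e + 2))).subtype.toRatAlgHom P₂)
    (hP₂ : WeierstrassCurve.Affine.Point.map (W' := W)
      (ringClassField K (jbar.comp (algebraMap K (AlgebraicClosure K))) (p ^ (e + 2))).subtype.toRatAlgHom P₂ =
      ModularForms.heegnerPointComplexOfConductor Dt (NumberField.discr K) β (p ^ (e + 2)))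
    (hx₂fix : ∀ σ ∈ ringClassSubgroup K (p ^ (e + 2)) jbar, σ • x₂ = x₂)
    {Λ : Subgroup (Field.absoluteGaloisGroup K)} (hΛ : ringClassSubgroup K (p ^ (e + 1)) jbar ≤ Λ)
    {A : Finset (Field.absoluteGaloisGroup K)} (hA : ∀ a ∈ A, a ∈ Λ)
    (htA : ∀ τ ∈ Λ, ∃! a, a ∈ A ∧ a⁻¹ * τ ∈ ringClassSubgroup K (p ^ (e + 1)) jbar)
    {R : Finset (Field.absoluteGaloisGroup K)} (hR : ∀ r ∈ R, r ∈ Λ)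
    (htR : ∀ τ ∈ Λ, ∃! r, r ∈ R ∧ r⁻¹ * τ ∈ ringClassSubgroup K (p ^ (e + 2)) jbar) :
    ∑ r ∈ R, r • x₂ = (W.frobeniusTrace p) • ∑ a ∈ A, a • x₁ - ∑ a ∈ A, a • x₀ := by
  have hc' : p ^ (e + 2) ≠ 0 := pow_ne_zero _ hp.ne_zero
  have hle : ringClassSubgroup K (p ^ (e + 2)) jbar ≤ ringClassSubgroup K (p ^ (e + 1)) jbar :=
    ringClassSubgroup_anti hK jbar (pow_dvd_pow p (Nat.le_succ _)) hc'
  -- a transversal `S` of `Gal(K̄/K[p^{e+2}])` in `Gal(K̄/K[p^{e+1}])`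
  haveI : (ringClassSubgroup K (p ^ (e + 2)) jbar).FiniteIndex := finiteIndex_ringClassSubgroup K _ jbar
  obtain ⟨S, hS, htS⟩ := exists_finset_transversal' (ringClassSubgroup K (p ^ (e + 2)) jbar)
    (ringClassSubgroup K (p ^ (e + 1)) jbar)
  -- decompose `R` through `Gal(K̄/K[p^{e+1}])` and apply the distribution relation to the inner sum
  rw [sum_smul_eq_sum_sum_smul hle hΛ hA htA hS htS hR htR hx₂fix,
    sum_transversal_smul_eq_frobeniusTrace_smul_sub hK hH Dt hβ jbar hp hpN e hx₀ hx₁ hx₂ hP₂ hS htS,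
    Finset.smul_sum, ← Finset.sum_sub_distrib]
  refine Finset.sum_congr rfl fun a _ ↦ ?_
  rw [smul_sub, smul_comm]

end Literature.NumberTheory.EllipticCurves

end
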